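/-
Copyright (c) 2026 the pub-hodgecm-mathlib formalisation cell (harness21).  Prover seat hodgecm-mathlib-K2E3-p04 (g0), Track B ∕ K2-LIT
(build stream 29), h413 = `stmt-HodgeConjecture-24833`, line `K2_E3_EllipticInputs`, unit U4 «Keys» — DEAL `K2E3RankOneIntertwiningIntegral`, RUNG 3 (convergence),
STEP 2b «ASSEMBLY»: the intertwining integral of `U(Φ₃)(L⁺_v)` CONVERGES for `Re s > 0`.  2026-09-03.
-/
import Summits.HodgeConjecture.HodgeConjecture.Theorems.K2E3RankOneIntertwiningIntegral        -- ★ RUNGS 1+2 (this seat, p855230): `exists_intertwiningIntegral_cmPrincipalSeries` (from `hint₀`)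
import Summits.HodgeConjecture.HodgeConjecture.Theorems.K2E3IntertwiningIntegralShellBound       -- ★ STEP 1 (this seat, p855288): `integrableOn_rpow_neg_of_scaling` (height-shell summability)
import Summits.HodgeConjecture.HodgeConjecture.Theorems.K2E3IntertwiningIntegralMajorant        -- ★ STEP 2a (this seat, p855338): `height_torusConj`, `norm_cellFun_eq_far_out`, `integrableOn_cellFun_normBall`
import Summits.HodgeConjecture.HodgeConjecture.Theorems.F0P3cStCharTSTorusDefs                  -- ★ `torusChart` (`d(α, ·, σ(α)⁻¹) ∈ T`), `coe_torusChart`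
import Literature.NumberTheory.Automorphic.CMXiTorusCharSplitTorusDecay                          -- ★ `exists_map_eq_unitModulusChar_lt_one` (a unit of modulus `< 1`)
import HarnessLib

/-!
# h413 ∕ Track B «K2-LIT», unit U4 «Keys», DEAL `K2E3RankOneIntertwiningIntegral` — RUNG 3 «CONVERGENCE»: for `|χ₁| = ‖·‖_E^σ` with `σ = Re s > 0` the intertwining integral
# `J(w, χ) f (g) = ∫_N f(w₀ n g) dn` on `i_G(χ₁, χ₂)` (`G = U(Φ₃)(L⁺_v)`, `v` non-split) CONVERGES ABSOLUTELY for every section, so `J(w, χ) ∈ Hom_G(i(χ), i(wχ))` exists, non-zero,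
# with the integral formula — UNCONDITIONALLY  [Casselman1995 §6.4; Keys1984 §3; BernsteinZelevinsky1977 §2]

Cell `pub/hodgecm-mathlib`, crux H413 = `stmt-HodgeConjecture-24833` (lane `--supports … --as helper`), route HCCMUnconditional; dealer K2E3-plan (g1) (DEALS BATCH #1
2026-09-03T22:03Z «p04 DEAL `Theorems/K2E3RankOneIntertwiningIntegral.lean` — … absolute convergence for `χ₁ = η‖·‖_E^s`, `Re s > s₀`, `J(w,χ) ∈ Hom_G(i(χ), i(wχ))` non-zero»).
THEOREMS ONLY (0 def ∕ 0 instance ∕ 0 notation ∕ 0 sorry); ★-only imports.  This file DISCHARGES the one hypothesis `hint₀` of ★ `exists_intertwiningIntegral_cmPrincipalSeries`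
and so completes the deal's first half with **`s₀ = 0`**.

THE MATHEMATICS ([Casselman1995, §6.4 p. 63]: on the big cell `|f(w₀ n)| = δ^{1∕2}|χ|(a(w₀ n))·|f(k)|`, and «the integral over `N` reduces to a geometric series»).  Height `m(u) = ‖u₀₂‖`
on `N(L⁺_v)` (the norm balls `K_A` of ★ `F0P3cStCharTSKeys3AnnulusDock`).  For a section `f` of `i_G(χ₁, χ₂)` with `‖χ₁(x)‖ = ‖x‖^σ`:
* on `K_{A₀}` the cell function is continuous on a compact set, hence integrable (★ STEP 2a `integrableOn_cellFun_normBall`);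
* far out `‖f(w₀ u)‖ = ‖f(1)‖ · m(u)^{-(σ+1)}` EXACTLY (★ STEP 2a `norm_cellFun_eq_far_out`, from ★ B4 «cell function far out»);
* `m^{-(σ+1)}` is integrable on `{A₀ < m}` by ★ STEP 1 `integrableOn_rpow_neg_of_scaling` fed with the torus element `t = d(α, 1, σ(α)⁻¹)` (★ `torusChart`), `‖α‖ < 1`
  (★ `exists_map_eq_unitModulusChar_lt_one`): `c = Ad(t⁻¹)` expands the height by `Q = ‖α‖⁻²` (★ STEP 2a `height_torusConj`) and scales the Haar measure of `N` by
  `κ = Δ_B(t) = ‖α‖²` (★ T2 `map_torusConj_cmBorel_eq_modularCharacter_nnreal_smul`, ★ `modularCharacter_cmBorel_torus`), and **`κ · Q^{σ+1} = ‖α‖^{−2σ} > 1 ⟺ σ > 0`**.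
* §1 **`integrable_cellFun`** — `∀ f ∈ i_G(χ₁, χ₂)`, `u ↦ f(w₀ u)` is integrable for every Haar measure of `N(L⁺_v)` (`σ > 0`, `v` non-split, `w₀` of matrix `Φ₃`).
* §2 **`exists_intertwiningIntegral_of_modulus`** — THE DEAL'S FIRST HALF, unconditional: **`∃ J : i_G(χ₁, χ₂) →_G i_G(χ̄₁⁻¹, χ₂)`, `J ≠ 0`, `(J f)(g) = ∫_N f(w₀ n g) dμ(n)`** whenever
  `‖χ₁‖ = ‖·‖^σ` with `σ > 0` (`χ₁ = η‖·‖_E^s`, `Re s > 0`) — ★ RUNG 1+2 at the section `f₀ = (w₀ n₀) · Φ` (`Φ` the open-cell section of ★ `exists_openCellSection_three`, `n₀ ∈ K`, so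
  `f₀(1) = Φ(w₀ n₀) = 1`).
WHAT IS NOT HERE: the region `Re s ≤ 0` (meromorphic continuation), the formula `J(w⁻¹, wχ) J(w, χ) = γ(χ)·id` (K2E3-p05's road I-3∕I-4), and `Hom_G(i(χ), i(wχ)) = ℂ·J` for regular `χ`
(★ `K2E3IntertwinerSpaceDimLeOne`, p07, gives it at once).

HONEST LABEL.  HC_CM is proved only modulo the 7 printed citations (2 remaining named inputs: hLiu418 = `stmt-HodgeConjecture-24832`, h413 = `stmt-HodgeConjecture-24833`) until
rung 0 closes; count-neutral (a classical theorem made available in house for the U4 «Keys» road).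

## References
* [Casselman1995] W. Casselman, *Introduction to the theory of admissible representations of `p`-adic reductive groups* (1995), §6.4 pp. 62–64 (convergence of `T_w` in the cone
  `|χ(a_α)| < 1`), Prop. 1.3.3, §3.2 Thm. 3.2.4.
* [Keys1984] D. Keys, *Principal series representations of special unitary groups over local fields*, Compositio Math. 51 (1984), §3 (the operators `A(w, λ)`, `Re s > 0`).
* [BernsteinZelevinsky1977] I. N. Bernstein, A. V. Zelevinsky, Ann. Sci. ÉNS 10 (1977), §2, Geometrical Lemma 2.12.
* [Rogawski1990] J. D. Rogawski, *Automorphic Representations of Unitary Groups in Three Variables* (1990), §1.10 p. 9, §12.2 p. 173.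
* [WeilBNT1967] A. Weil, *Basic Number Theory* (1967), Ch. I §2, Ch. II §5 Prop. 12.
-/

set_option autoImplicit false
-- the mandated namespace repeats the single-problem summit's segment (`HodgeConjecture.HodgeConjecture`)
set_option linter.dupNamespace false

noncomputable section

open NumberField IsDedekindDomain MeasureTheory
open scoped Matrix NNReal ENNReal

open Literature.NumberTheory Literature.NumberTheory.Automorphic Literature.NumberTheory.Automorphic.UnitaryGroup
open Literature.NumberTheory.GaloisRepresentations Literature.NumberTheory.GaloisRepresentations.IsNonarchimedeanLocalField

namespace Summit.HodgeConjecture.HodgeConjecture.Cruxes.H413.K2E3RankOneIntertwiningIntegralConvergence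

variable (L : Type) [Field L] [NumberField L] [IsCMField L] (v : HeightOneSpectrum (𝓞 ↥(maximalRealSubfield L)))
  (hns : ∀ w : PlacesOver L v, IsCMField.complexConj L • w.1 = w.1)

/-! ## §1 Every cell function of `i_G(χ₁, χ₂)`, `|χ₁| = ‖·‖^σ`, `σ > 0`, is integrable on `N(L⁺_v)` -/

set_option synthInstance.maxHeartbeats 400000 in
set_option maxHeartbeats 6000000 in
-- statement∕proof over the `SmoothInd` carrier of ★ `cmPrincipalSeries` + the height-shell bookkeeping (class of ★ `F0P3cStCharTSKeys3AnnulusDock`)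
include hns in
/-- **CONVERGENCE OF THE INTERTWINING INTEGRAND.**  `v` NON-SPLIT, `w₀` of matrix `Φ₃`, `χ₂` continuous, `χ₁` with `‖χ₁(x)‖ = ‖x‖^σ` for all units `x` and **`σ > 0`**; then for EVERY `f` in the
carrier of ★ `cmPrincipalSeries L 3 v (cmTorusCharPair L v χ₁ χ₂)` and every Haar measure `μ` of `N(L⁺_v)` the cell function `u ↦ f(w₀ u)` is `μ`-INTEGRABLE: on the norm ball `K_{A₀}` by
★ `integrableOn_cellFun_normBall`; on `{A₀ < m}` it has norm `‖f(1)‖ · m^{-(σ+1)}` (★ `norm_cellFun_eq_far_out`), integrable by ★ `integrableOn_rpow_neg_of_scaling` at `c = Ad(t⁻¹)`,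
`t = d(α, 1, σ(α)⁻¹)` with `‖α‖ < 1` (★ `exists_map_eq_unitModulusChar_lt_one`, ★ `torusChart`): `Q = ‖α‖⁻²` (★ `height_torusConj`), `κ = ‖α‖²` (★ T2 + ★ `modularCharacter_cmBorel_torus`),
`κ Q^{σ+1} = (‖α‖²)^{-σ} > 1`. [cite: Casselman1995, §6.4 pp. 62–64] [cite: Keys1984, §3] [cite: WeilBNT1967, Ch. II §5 Prop. 12] -/
theorem integrable_cellFun
    (χ₁ : (LocalRing L v)ˣ →* ℂˣ) (χ₂ : ↥(normOneUnits (conjLocal L (IsCMField.complexConj L) v)) →* ℂˣ)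
    (h₂ : Continuous fun x => ((χ₂ x : ℂˣ) : ℂ)) {σ : ℝ} (hσ : 0 < σ)
    (hχ₁ : ∀ x : (LocalRing L v)ˣ, ‖((χ₁ x : ℂˣ) : ℂ)‖ = ((unitModulusChar (LocalRing L v) x : ℝ≥0) : ℝ) ^ σ)
    (w₀ : ↥(unitaryGroupOfForm (conjLocal L (IsCMField.complexConj L) v) (cmLocalForm L 3 v))) (hw₀ : Units.val (w₀ : GL (Fin 3) (LocalRing L v)) = cmLocalForm L 3 v)
    [MeasurableSpace ↥(cmBorelTriple L 3 v).N] [BorelSpace ↥(cmBorelTriple L 3 v).N] (μ : Measure ↥(cmBorelTriple L 3 v).N) [μ.IsHaarMeasure]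
    (f : haveI := locallyCompactSpace_cmBorelU L 3 v
      Representation.SmoothInd (cmBorelTriple L 3 v).P
        (Representation.twist
          (((Representation.trivial ℂ ↥(torusU (conjLocal L (IsCMField.complexConj L) v) (cmLocalForm L 3 v)) ℂ).twist
            (cmTorusCharPair L v χ₁ χ₂)).comp (cmBorelTriple L 3 v).proj) (rootDeltaChar (cmBorelTriple L 3 v).P))) :
    Integrable (fun u : ↥(cmBorelTriple L 3 v).N => f.toFun (w₀ * (u : ↥(unitaryGroupOfForm (conjLocal L (IsCMField.complexConj L) v) (cmLocalForm L 3 v))))) μ := by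
  haveI := locallyCompactSpace_cmBorelU L 3 v
  letI : MeasurableSpace (LocalRing L v) := borel _
  haveI : BorelSpace (LocalRing L v) := ⟨rfl⟩
  obtain ⟨A₀, hA₀, hfar⟩ := K2E3IntertwiningIntegralMajorant.norm_cellFun_eq_far_out L v hns χ₁ χ₂ h₂ hχ₁ w₀ hw₀ f
  -- the ball
  have hball : IntegrableOn (fun u : ↥(cmBorelTriple L 3 v).N => f.toFun (w₀ * (u : ↥(unitaryGroupOfForm (conjLocal L (IsCMField.complexConj L) v) (cmLocalForm L 3 v)))))
      {u : ↥(cmBorelTriple L 3 v).N | (((∏ w' : PlacesOver L v, normAbs (w'.1.adicCompletion L) ((((((u : ↥(unitaryGroupOfForm (conjLocal L (IsCMField.complexConj L) v) (cmLocalForm L 3 v)))) : GL (Fin 3) (LocalRing L v)) : Matrix (Fin 3) (Fin 3) (LocalRing L v)) 0 2) w')) : ℝ≥0) : ℝ) ≤ A₀} μ :=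
    K2E3IntertwiningIntegralMajorant.integrableOn_cellFun_normBall L v hns _ w₀ μ f A₀
  -- the tail: the torus element `t = d(α, 1, σ(α)⁻¹)`, `‖α‖ < 1`
  obtain ⟨α, -, hα⟩ := exists_map_eq_unitModulusChar_lt_one (L := L) (v := v) (conjLocal L (IsCMField.complexConj L) v)
  set t : ↥(cmBorelTriple L 3 v).M := F0P3cStCharTSTorusDefs.torusChart L v (α, 1) with ht
  have hd : glDiagonal 3 (LocalRing L v) (F0P3cStCharTSTorusDefs.torusChartEntries L v (α, 1)) = ((t : ↥(unitaryGroupOfForm (conjLocal L (IsCMField.complexConj L) v) (cmLocalForm L 3 v))) : GL (Fin 3) (LocalRing L v)) :=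
    (F0P3cStCharTSTorusDefs.coe_torusChart L v (α, 1)).symm
  have hd0 : F0P3cStCharTSTorusDefs.torusChartEntries L v (α, 1) 0 = α := rfl
  set a : ℝ := ((unitModulusChar (LocalRing L v) α : ℝ≥0) : ℝ) with ha
  have ha0 : 0 < a := NNReal.coe_pos.2 distribHaarChar_pos
  have ha1 : a < 1 := by rw [ha, ← NNReal.coe_one]; exact NNReal.coe_lt_coe.2 hα
  have hA : 0 < a * a := mul_pos ha0 ha0
  have hA1 : a * a < 1 := mul_lt_one_of_nonneg_of_lt_one_left ha0.le ha1 ha1.le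
  -- height, conjugation, Jacobian
  have hm : Measurable fun u : ↥(cmBorelTriple L 3 v).N => (((∏ w' : PlacesOver L v, normAbs (w'.1.adicCompletion L) ((((((u : ↥(unitaryGroupOfForm (conjLocal L (IsCMField.complexConj L) v) (cmLocalForm L 3 v)))) : GL (Fin 3) (LocalRing L v)) : Matrix (Fin 3) (Fin 3) (LocalRing L v)) 0 2) w')) : ℝ≥0) : ℝ) := (F0P3cStCharTSKeys3AnnulusDock.continuous_norm_entry L v).measurable
  have hc : Measurable (HeisRing.torusConj (conjLocal L (IsCMField.complexConj L) v) t) :=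
    (HeisRing.continuous_torusConj (conjLocal L (IsCMField.complexConj L) v) t).measurable
  have hκ := map_torusConj_cmBorel_eq_modularCharacter_nnreal_smul L v t μ
  have hκval : (Measure.modularCharacter (⟨(t : ↥(unitaryGroupOfForm (conjLocal L (IsCMField.complexConj L) v) (cmLocalForm L 3 v))), torusU_le_borelU _ _ t.2⟩ : ↥(cmBorelTriple L 3 v).P) : ℝ≥0) =
      unitModulusChar (LocalRing L v) α * unitModulusChar (LocalRing L v) α := by
    rw [F0P2oBorelTorusModulus.modularCharacter_cmBorel_torus L v t hd, hd0]
  have hκ0 : (Measure.modularCharacter (⟨(t : ↥(unitaryGroupOfForm (conjLocal L (IsCMField.complexConj L) v) (cmLocalForm L 3 v))), torusU_le_borelU _ _ t.2⟩ : ↥(cmBorelTriple L 3 v).P) : ℝ≥0) ≠ 0 := by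
    rw [hκval]; exact (mul_pos distribHaarChar_pos distribHaarChar_pos).ne'
  have hmc : ∀ u : ↥(cmBorelTriple L 3 v).N,
      (((∏ w' : PlacesOver L v, normAbs (w'.1.adicCompletion L) (((((((HeisRing.torusConj (conjLocal L (IsCMField.complexConj L) v) t u : ↥(cmBorelTriple L 3 v).N) : ↥(unitaryGroupOfForm (conjLocal L (IsCMField.complexConj L) v) (cmLocalForm L 3 v)))) : GL (Fin 3) (LocalRing L v)) : Matrix (Fin 3) (Fin 3) (LocalRing L v)) 0 2) w')) : ℝ≥0) : ℝ) = (a * a)⁻¹ * (((∏ w' : PlacesOver L v, normAbs (w'.1.adicCompletion L) ((((((u : ↥(unitaryGroupOfForm (conjLocal L (IsCMField.complexConj L) v) (cmLocalForm L 3 v)))) : GL (Fin 3) (LocalRing L v)) : Matrix (Fin 3) (Fin 3) (LocalRing L v)) 0 2) w')) : ℝ≥0) : ℝ) := by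
    intro u
    rw [K2E3IntertwiningIntegralMajorant.height_torusConj L v t hd u, hd0, NNReal.coe_mul, NNReal.coe_mul, NNReal.coe_inv, ha, mul_inv]
    rfl
  have hQ : 0 < (a * a)⁻¹ := inv_pos.2 hA
  have hQ1 : 1 < (a * a)⁻¹ := (one_lt_inv₀ hA).2 hA1
  have hκQ : 1 < ((Measure.modularCharacter (⟨(t : ↥(unitaryGroupOfForm (conjLocal L (IsCMField.complexConj L) v) (cmLocalForm L 3 v))), torusU_le_borelU _ _ t.2⟩ : ↥(cmBorelTriple L 3 v).P) : ℝ≥0) : ℝ) * ((a * a)⁻¹) ^ (σ + 1) := by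
    rw [hκval, NNReal.coe_mul, ← ha, Real.rpow_add hQ, Real.rpow_one, mul_left_comm, mul_inv_cancel₀ hA.ne', mul_one]
    exact Real.one_lt_rpow hQ1 hσ
  have htail' := K2E3IntertwiningIntegralShellBound.integrableOn_rpow_neg_of_scaling μ hm hc hκ hQ hmc hκ0 hQ1 hA₀
    (K2E3IntertwiningIntegralMajorant.measure_normBall_lt_top L v hns μ A₀).ne (add_pos hσ one_pos) hκQ
  have htail : IntegrableOn (fun u : ↥(cmBorelTriple L 3 v).N => f.toFun (w₀ * (u : ↥(unitaryGroupOfForm (conjLocal L (IsCMField.complexConj L) v) (cmLocalForm L 3 v)))))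
      {u : ↥(cmBorelTriple L 3 v).N | A₀ < (((∏ w' : PlacesOver L v, normAbs (w'.1.adicCompletion L) ((((((u : ↥(unitaryGroupOfForm (conjLocal L (IsCMField.complexConj L) v) (cmLocalForm L 3 v)))) : GL (Fin 3) (LocalRing L v)) : Matrix (Fin 3) (Fin 3) (LocalRing L v)) 0 2) w')) : ℝ≥0) : ℝ)} μ := by
    refine Integrable.mono' (htail'.const_mul ‖f.toFun 1‖) ?_ ?_
    · exact (SmoothInd.continuous_cellFun (cmBorelTriple L 3 v).P _ (cmBorelTriple L 3 v).N.subtype w₀ continuous_subtype_val f).aestronglyMeasurable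
    · filter_upwards [ae_restrict_mem (measurableSet_lt measurable_const hm)] with u hu
      exact (hfar u hu).le
  have hunion := hball.union htail
  have huniv : {u : ↥(cmBorelTriple L 3 v).N | (((∏ w' : PlacesOver L v, normAbs (w'.1.adicCompletion L) ((((((u : ↥(unitaryGroupOfForm (conjLocal L (IsCMField.complexConj L) v) (cmLocalForm L 3 v)))) : GL (Fin 3) (LocalRing L v)) : Matrix (Fin 3) (Fin 3) (LocalRing L v)) 0 2) w')) : ℝ≥0) : ℝ) ≤ A₀} ∪ {u : ↥(cmBorelTriple L 3 v).N | A₀ < (((∏ w' : PlacesOver L v, normAbs (w'.1.adicCompletion L) ((((((u : ↥(unitaryGroupOfForm (conjLocal L (IsCMField.complexConj L) v) (cmLocalForm L 3 v)))) : GL (Fin 3) (LocalRing L v)) : Matrix (Fin 3) (Fin 3) (LocalRing L v)) 0 2) w')) : ℝ≥0) : ℝ)} = Set.univ :=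
    Set.eq_univ_of_forall fun u => (le_or_gt (((∏ w' : PlacesOver L v, normAbs (w'.1.adicCompletion L) ((((((u : ↥(unitaryGroupOfForm (conjLocal L (IsCMField.complexConj L) v) (cmLocalForm L 3 v)))) : GL (Fin 3) (LocalRing L v)) : Matrix (Fin 3) (Fin 3) (LocalRing L v)) 0 2) w')) : ℝ≥0) : ℝ) A₀).elim (fun h => Or.inl h) (fun h => Or.inr h)
  rw [huniv] at hunion
  exact integrableOn_univ.1 hunion

/-! ## §2 The deal's first half, unconditional: `J(w, χ) ∈ Hom_G(i_G(χ₁, χ₂), i_G(χ̄₁⁻¹, χ₂))`, non-zero, with the integral formula, for `Re s > 0` -/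

set_option synthInstance.maxHeartbeats 400000 in
set_option maxHeartbeats 8000000 in
-- statement∕proof over the two `SmoothInd` carriers of ★ `cmPrincipalSeries` (class of ★ RUNG 1+2 `exists_intertwiningIntegral_cmPrincipalSeries`)
include hns in
/-- **THE RANK-ONE INTERTWINING INTEGRAL EXISTS AND IS NON-ZERO FOR `Re s > 0` (unconditional).**  `G = U(Φ₃)(L⁺_v)`, `v` NON-SPLIT, `w₀ ∈ G` of matrix `Φ₃`, `μ` ANY Haar measure of
`N(L⁺_v)`, `χ₂` continuous, `χ₁` continuous with `‖χ₁(x)‖ = ‖x‖_E^σ` for all units and `σ > 0` (i.e. `χ₁ = η‖·‖_E^s`, `η` unitary, `σ = Re s > 0`).  Then there is a `G`-map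
**`J : i_G(χ₁, χ₂) → i_G(χ̄₁⁻¹, χ₂)`** (★ `cmPrincipalSeries`, `wχ` spelled ★ `cmTorusCharPair L v (conjInvChar σ χ₁) χ₂`) with **`J ≠ 0`** and **`(J f)(g) = ∫_N f(w₀ n g) dμ(n)`** for every section
`f` and `g ∈ G` — Casselman's `T_w`, Keys' `A(w, λ)` [Casselman1995, §6.4; Keys1984, §3].  ★ RUNG 1+2 `exists_intertwiningIntegral_cmPrincipalSeries` at `f₀ = (w₀ n₀)·Φ` (`Φ` the open-cell section,
`f₀(1) = Φ(w₀ n₀) = 1`), its `hint₀` discharged by §1. [cite: Casselman1995, §6.4 pp. 62–64; Thm. 3.2.4 p. 34] [cite: Keys1984, §3] [cite: BernsteinZelevinsky1977, §2, Geometrical Lemma 2.12] [cite: Rogawski1990, §12.2 p. 173] -/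
theorem exists_intertwiningIntegral_of_modulus
    (χ₁ : (LocalRing L v)ˣ →* ℂˣ) (χ₂ : ↥(normOneUnits (conjLocal L (IsCMField.complexConj L) v)) →* ℂˣ)
    (h₁ : Continuous fun x => ((χ₁ x : ℂˣ) : ℂ)) (h₂ : Continuous fun x => ((χ₂ x : ℂˣ) : ℂ)) {σ : ℝ} (hσ : 0 < σ)
    (hχ₁ : ∀ x : (LocalRing L v)ˣ, ‖((χ₁ x : ℂˣ) : ℂ)‖ = ((unitModulusChar (LocalRing L v) x : ℝ≥0) : ℝ) ^ σ)
    (w₀ : ↥(unitaryGroupOfForm (conjLocal L (IsCMField.complexConj L) v) (cmLocalForm L 3 v))) (hw₀ : Units.val (w₀ : GL (Fin 3) (LocalRing L v)) = cmLocalForm L 3 v)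
    [MeasurableSpace ↥(cmBorelTriple L 3 v).N] [BorelSpace ↥(cmBorelTriple L 3 v).N] (μ : Measure ↥(cmBorelTriple L 3 v).N) [μ.IsHaarMeasure] :
    ∃ J : (cmPrincipalSeries L 3 v (cmTorusCharPair L v χ₁ χ₂)).IntertwiningMap
        (cmPrincipalSeries L 3 v (cmTorusCharPair L v (conjInvChar (conjLocal L (IsCMField.complexConj L) v) χ₁) χ₂)),
      J ≠ 0 ∧
      ∀ (f : haveI := locallyCompactSpace_cmBorelU L 3 v
          Representation.SmoothInd (cmBorelTriple L 3 v).P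
        (Representation.twist
          (((Representation.trivial ℂ ↥(torusU (conjLocal L (IsCMField.complexConj L) v) (cmLocalForm L 3 v)) ℂ).twist
            (cmTorusCharPair L v χ₁ χ₂)).comp (cmBorelTriple L 3 v).proj) (rootDeltaChar (cmBorelTriple L 3 v).P)))
        (g : ↥(unitaryGroupOfForm (conjLocal L (IsCMField.complexConj L) v) (cmLocalForm L 3 v))),
        (J f).toFun g = ∫ n : ↥(cmBorelTriple L 3 v).N, f.toFun (w₀ * (n : ↥(unitaryGroupOfForm (conjLocal L (IsCMField.complexConj L) v) (cmLocalForm L 3 v))) * g) ∂μ := by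
  haveI := locallyCompactSpace_cmBorelU L 3 v
  -- a section with `f₀(1) ≠ 0`: translate the open-cell section `Φ` (`Φ(w₀ n) = 1_K(n)`) by `w₀ n₀`, `n₀ ∈ K`
  obtain ⟨Φ, -, K, -, -, ⟨n₀, hn₀⟩, hΦ⟩ := F0P3U3PrincipalSeriesOpenCellTorusChar.exists_openCellSection_three L v w₀ hw₀ χ₁ χ₂ h₁ h₂
  have hf₀ : (Representation.smoothIndRep (cmBorelTriple L 3 v).P _ (w₀ * (n₀ : ↥(unitaryGroupOfForm (conjLocal L (IsCMField.complexConj L) v) (cmLocalForm L 3 v)))) Φ).toFun 1 ≠ 0 := by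
    rw [Representation.toFun_smoothIndRep_apply, one_mul, hΦ n₀, Set.indicator_of_mem hn₀]
    exact one_ne_zero
  exact K2E3RankOneIntertwiningIntegral.exists_intertwiningIntegral_cmPrincipalSeries L v hns χ₁ χ₂ h₁ h₂ w₀ hw₀ μ _ hf₀
    (integrable_cellFun L v hns χ₁ χ₂ h₂ hσ hχ₁ w₀ hw₀ μ _)

end Summit.HodgeConjecture.HodgeConjecture.Cruxes.H413.K2E3RankOneIntertwiningIntegralConvergence

end
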